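import Mathlib
import HarnessLib
import Summits.ABC.ABC.Theses.CongruentialReceptacle
import Summits.ABC.ABC.Theorems.CompactBalanceTransfer.Negative.CuspWeightedResidueFree

/-!
# `CompactBalanceTransfer` (stmt-ABC-1725), line `Sketch` — the stub at an EXACT finite level

Infrastructure for every refutation certificate of the line's stub `CuspWeightedReceptacle` (residue-dependent tables
`t(p; v_p a, v_p b, v_p c; a′, b′, c′ mod p)`), written by the line lead (`prover-line-stmt-ABC-1725-0`, 2026-08-16) for
the lead's and the disprover's later cycles.

The stub hands out, for every admissible modulus `ℓⁿ`, a windowed table whose triple sums are `≡ B (mod ℓⁿ)` with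
`|B| ≤ c₃`. `cuspWeighted_exact_level` converts this into what certificates actually consume: for every height bound
`X` ONE windowed table `t` (the one at a single prime modulus `ℓ > X` that also exceeds the a-priori window bound
`2|c₁′| log X + c₃`) such that `|Σ_{p ∣ abc} t(p; …)| ≤ c₃` holds EXACTLY (in `ℝ`, no modulus) for every abc-triple with
`abc ≤ X`. The a-priori bound is `|Σ_p t| ≤ |c₁′| Σ_{p ∣ abc} (v_p(abc) + 1) log p ≤ 2|c₁′| log(abc)` (upper window and
`v_p a + v_p b + v_p c = v_p(abc)`), and congruence-to-equality is `eq_of_modEq_of_abs_le` of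
`Negative/CuspWeightedResidueFree.lean`. A certificate against the stub is then any finite family of triples below some
`X = X(ε, c₁, c₁′, c₃)` on which no windowed table has all sums in `[−c₃, c₃]` (`not_stub_of_level_certificate`).
-/

-- `Summit.<Summit>.<Problem>`: for the single-conjunct summit `ABC` the duplicate `ABC.ABC` is mandated.
set_option linter.dupNamespace false

namespace Summit.ABC.ABC.Theorems.CompactBalanceTransfer.Negative

open Literature.NumberTheory.DiophantineGeometry

/-- A-priori bound from the upper window: if `|t(p; i,j,k; r,s,z)| ≤ c₁′ (i+j+k+1) log p` at every prime, then for
positive `a, b, c` with `N = abc`, `|Σ_{p ∣ N} t(p; v_p a, v_p b, v_p c; …)| ≤ 2 |c₁′| log N` (because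
`v_p a + v_p b + v_p c = v_p N ≥ 1` on the support and `Σ_p v_p(N) log p = log N`). [folklore] -/
theorem abs_tripleSum_le_two_mul_log {c₁' : ℝ} {t : ℕ → ℕ → ℕ → ℕ → ℕ → ℕ → ℕ → ℤ}
    (ht : ∀ p i j k r s z : ℕ, p.Prime → |(t p i j k r s z : ℝ)| ≤ c₁' * (((i + j + k : ℕ) : ℝ) + 1) * Real.log p)
    {a b c : ℕ} (ha : 0 < a) (hb : 0 < b) (hc : 0 < c) (r s z : ℕ → ℕ) :
    |((∑ p ∈ (a * b * c).primeFactors,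
        t p (a.factorization p) (b.factorization p) (c.factorization p) (r p) (s p) (z p) : ℤ) : ℝ)|
      ≤ 2 * |c₁'| * Real.log ((a * b * c : ℕ) : ℝ) := by
  set N : ℕ := a * b * c with hN
  have hN0 : N ≠ 0 := by positivity
  have hfac : ∀ p : ℕ, a.factorization p + b.factorization p + c.factorization p = N.factorization p := by
    intro p
    rw [hN, Nat.factorization_mul (by positivity) hc.ne', Nat.factorization_mul ha.ne' hb.ne']
    simp [Finsupp.add_apply]
  have hlogN : Real.log (N : ℝ) = ∑ p ∈ N.primeFactors, ((N.factorization p : ℕ) : ℝ) * Real.log p := by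
    rw [Real.log_nat_eq_sum_factorization, Finsupp.sum, Nat.support_factorization]
  rw [Int.cast_sum]
  refine (Finset.abs_sum_le_sum_abs _ _).trans ?_
  calc ∑ p ∈ N.primeFactors, |((t p (a.factorization p) (b.factorization p) (c.factorization p)
          (r p) (s p) (z p) : ℤ) : ℝ)|
      ≤ ∑ p ∈ N.primeFactors, |c₁'| * (2 * (((N.factorization p : ℕ) : ℝ) * Real.log p)) := by
        refine Finset.sum_le_sum fun p hp => ?_
        have pp := Nat.prime_of_mem_primeFactors hp
        have hlogp : 0 ≤ Real.log p := Real.log_natCast_nonneg p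
        have h1 := ht p (a.factorization p) (b.factorization p) (c.factorization p) (r p) (s p) (z p) pp
        rw [hfac p] at h1
        have hv1 : (1 : ℝ) ≤ ((N.factorization p : ℕ) : ℝ) := by
          exact_mod_cast Nat.Prime.factorization_pos_of_dvd pp hN0 (Nat.dvd_of_mem_primeFactors hp)
        have h2 : c₁' * ((((N.factorization p : ℕ) : ℝ)) + 1) * Real.log p
            ≤ |c₁'| * ((((N.factorization p : ℕ) : ℝ)) + 1) * Real.log p :=
          mul_le_mul_of_nonneg_right (mul_le_mul_of_nonneg_right (le_abs_self _) (by positivity)) hlogp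
        have h3 : |c₁'| * ((((N.factorization p : ℕ) : ℝ)) + 1) * Real.log p
            ≤ |c₁'| * (2 * (((N.factorization p : ℕ) : ℝ) * Real.log p)) := by
          have : ((((N.factorization p : ℕ) : ℝ)) + 1) * Real.log p
              ≤ 2 * (((N.factorization p : ℕ) : ℝ) * Real.log p) := by nlinarith
          calc |c₁'| * ((((N.factorization p : ℕ) : ℝ)) + 1) * Real.log p
              = |c₁'| * (((((N.factorization p : ℕ) : ℝ)) + 1) * Real.log p) := by ring
            _ ≤ |c₁'| * (2 * (((N.factorization p : ℕ) : ℝ) * Real.log p)) :=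
                mul_le_mul_of_nonneg_left this (abs_nonneg _)
        exact h1.trans (h2.trans h3)
    _ = 2 * |c₁'| * Real.log (N : ℝ) := by
        rw [hlogN, Finset.mul_sum]
        refine Finset.sum_congr rfl fun p _ => ?_
        ring

/-- **The stub at an exact finite level.** From the residue-dependent cusp-weighted receptacle with constants
`c₁, c₁′, c₃, m₀` (for one `ε`): for every `X` there is ONE windowed table whose triple sums satisfy `|Σ_p t| ≤ c₃`
exactly for all abc-triples with `abc ≤ X` — read the receptacle at a prime `ℓ > max(X, m₀, 4·|c₁′|·log X + 2c₃)` with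
`n = 1`, where every congruence is an identity. [folklore] -/
theorem cuspWeighted_exact_level (ε c₁ c₁' c₃ : ℝ) (m₀ : ℕ)
    (H : ∀ ℓ n : ℕ, ℓ.Prime → 5 ≤ ℓ → m₀ ≤ ℓ ^ n →
      ∃ t : ℕ → ℕ → ℕ → ℕ → ℕ → ℕ → ℕ → ℤ,
        (∀ p i j k r s z : ℕ, p.Prime →
          c₁ * (((k : ℕ) : ℝ) - 1 - ε) * Real.log p ≤ (t p i j k r s z : ℝ) ∧
          |(t p i j k r s z : ℝ)| ≤ c₁' * (((i + j + k : ℕ) : ℝ) + 1) * Real.log p) ∧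
        ∀ a b c : ℕ, IsABCTriple a b c → ¬ ℓ ∣ a * b * c →
          ∃ B : ℤ, |(B : ℝ)| ≤ c₃ ∧
            (∑ p ∈ (a * b * c).primeFactors,
                t p (a.factorization p) (b.factorization p) (c.factorization p)
                  (a / p ^ a.factorization p % p) (b / p ^ b.factorization p % p)
                  (c / p ^ c.factorization p % p)) ≡ B [ZMOD ((ℓ ^ n : ℕ) : ℤ)])
    (X : ℕ) :
    ∃ t : ℕ → ℕ → ℕ → ℕ → ℕ → ℕ → ℕ → ℤ,
      (∀ p i j k r s z : ℕ, p.Prime →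
        c₁ * (((k : ℕ) : ℝ) - 1 - ε) * Real.log p ≤ (t p i j k r s z : ℝ) ∧
        |(t p i j k r s z : ℝ)| ≤ c₁' * (((i + j + k : ℕ) : ℝ) + 1) * Real.log p) ∧
      ∀ a b c : ℕ, IsABCTriple a b c → a * b * c ≤ X →
        |((∑ p ∈ (a * b * c).primeFactors,
            t p (a.factorization p) (b.factorization p) (c.factorization p)
              (a / p ^ a.factorization p % p) (b / p ^ b.factorization p % p)
              (c / p ^ c.factorization p % p) : ℤ) : ℝ)| ≤ c₃ := by
  -- uniform a-priori bound below height X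
  set Z : ℝ := 2 * |c₁'| * Real.log ((X : ℕ) : ℝ) with hZ
  obtain ⟨ℓ, hℓge, hℓp⟩ := Nat.exists_infinite_primes (X + m₀ + 5 + ⌈Z + c₃⌉₊ + 1)
  have h5 : 5 ≤ ℓ := by omega
  have hm₀ : m₀ ≤ ℓ ^ 1 := by rw [pow_one]; omega
  have hℓR : Z + c₃ < ((ℓ ^ 1 : ℕ) : ℝ) := by
    have h1 : ((⌈Z + c₃⌉₊ : ℕ) : ℝ) + 1 ≤ (ℓ : ℝ) := by
      exact_mod_cast (show ⌈Z + c₃⌉₊ + 1 ≤ ℓ by omega)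
    rw [pow_one]
    linarith [Nat.le_ceil (Z + c₃)]
  obtain ⟨t, ht, hT⟩ := H ℓ 1 hℓp h5 hm₀
  refine ⟨t, ht, fun a b c habc hX => ?_⟩
  have ha : 0 < a := habc.1
  have hb : 0 < b := habc.2.1
  have hc : 0 < c := by have := habc.2.2.1; omega
  have hN0 : 0 < a * b * c := by positivity
  have hnd : ¬ ℓ ∣ a * b * c := Nat.not_dvd_of_pos_of_lt hN0 (by omega)
  obtain ⟨B, hB, hcong⟩ := hT a b c habc hnd
  -- a-priori bound for this triple, then monotonicity of log up to X
  have hS := abs_tripleSum_le_two_mul_log (fun p i j k r s z hp => (ht p i j k r s z hp).2) ha hb hc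
    (fun p => a / p ^ a.factorization p % p) (fun p => b / p ^ b.factorization p % p)
    (fun p => c / p ^ c.factorization p % p)
  have hlogle : Real.log ((a * b * c : ℕ) : ℝ) ≤ Real.log ((X : ℕ) : ℝ) :=
    Real.log_le_log (by exact_mod_cast hN0) (by exact_mod_cast hX)
  have hSZ : |((∑ p ∈ (a * b * c).primeFactors,
      t p (a.factorization p) (b.factorization p) (c.factorization p)
        (a / p ^ a.factorization p % p) (b / p ^ b.factorization p % p)
        (c / p ^ c.factorization p % p) : ℤ) : ℝ)| ≤ Z := by
    refine hS.trans ?_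
    rw [hZ]
    exact mul_le_mul_of_nonneg_left hlogle (by positivity)
  have hEq := eq_of_modEq_of_abs_le hcong hSZ hB hℓR
  rw [hEq]
  exact hB

/-- **Certificate interface.** To refute the stub it suffices to exhibit, for every `ε > 0` and all constants
`c₁ > 0, c₁′, c₃`, a height `X` below which NO windowed table has all its abc-triple sums in `[−c₃, c₃]`. -/
theorem not_stub_of_level_certificate
    (cert : ∀ ε : ℝ, 0 < ε → ∀ c₁ c₁' c₃ : ℝ, 0 < c₁ → ∃ X : ℕ,
      ∀ t : ℕ → ℕ → ℕ → ℕ → ℕ → ℕ → ℕ → ℤ,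
        (∀ p i j k r s z : ℕ, p.Prime →
          c₁ * (((k : ℕ) : ℝ) - 1 - ε) * Real.log p ≤ (t p i j k r s z : ℝ) ∧
          |(t p i j k r s z : ℝ)| ≤ c₁' * (((i + j + k : ℕ) : ℝ) + 1) * Real.log p) →
        ∃ a b c : ℕ, IsABCTriple a b c ∧ a * b * c ≤ X ∧
          c₃ < |((∑ p ∈ (a * b * c).primeFactors,
            t p (a.factorization p) (b.factorization p) (c.factorization p)
              (a / p ^ a.factorization p % p) (b / p ^ b.factorization p % p)
              (c / p ^ c.factorization p % p) : ℤ) : ℝ)|) :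
    ¬ (∀ ε : ℝ, 0 < ε → ∃ c₁ c₁' c₃ : ℝ, 0 < c₁ ∧ ∃ m₀ : ℕ, ∀ ℓ n : ℕ, ℓ.Prime → 5 ≤ ℓ → m₀ ≤ ℓ ^ n →
      ∃ t : ℕ → ℕ → ℕ → ℕ → ℕ → ℕ → ℕ → ℤ,
        (∀ p i j k r s z : ℕ, p.Prime →
          c₁ * (((k : ℕ) : ℝ) - 1 - ε) * Real.log p ≤ (t p i j k r s z : ℝ) ∧
          |(t p i j k r s z : ℝ)| ≤ c₁' * (((i + j + k : ℕ) : ℝ) + 1) * Real.log p) ∧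
        ∀ a b c : ℕ, IsABCTriple a b c → ¬ ℓ ∣ a * b * c →
          ∃ B : ℤ, |(B : ℝ)| ≤ c₃ ∧
            (∑ p ∈ (a * b * c).primeFactors,
                t p (a.factorization p) (b.factorization p) (c.factorization p)
                  (a / p ^ a.factorization p % p) (b / p ^ b.factorization p % p)
                  (c / p ^ c.factorization p % p)) ≡ B [ZMOD ((ℓ ^ n : ℕ) : ℤ)]) := by
  intro h
  obtain ⟨c₁, c₁', c₃, hc₁, m₀, H⟩ := h 1 one_pos
  obtain ⟨X, hX⟩ := cert 1 one_pos c₁ c₁' c₃ hc₁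
  obtain ⟨t, ht, hT⟩ := cuspWeighted_exact_level 1 c₁ c₁' c₃ m₀ H X
  obtain ⟨a, b, c, habc, hle, hgt⟩ := hX t ht
  exact absurd (hT a b c habc hle) (not_le.mpr hgt)

end Summit.ABC.ABC.Theorems.CompactBalanceTransfer.Negative
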